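import Summits.Ventures.QEC.CircuitDistance.PortWindow
import HarnessLib

/-!
# P3-PORT (F): COMPOSITION — the value of `d_circ` from the two finite facts (cell `qec`, experiment CDX, seat qec-cdx-type-1)

* the `sInf` bridge **`circuitDistance_eq_of_hasAt`** (`1 ≤ w`, no undetectable logical set of `≤ w−1` operations, one of
  `≤ w` in the `Nc`-circuit ⇒ `circuitDistance S Nc = w`), `hasAt_iff_le_circuitDistance`, `hasAt_mono_weight`;
* **`circuitDistance_eq_of`**: from «no undetectable logical fault set of `≤ w−1` operations in the `(w−1)`-cycle circuit»
  (the fibre files, via the window lemma) and «an undetectable logical fault set of `≤ w` operations in the `N₁`-cycle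
  circuit» (eng-1's `Witnesses`, via monotonicity) conclude `circuitDistance S Nc = w` for EVERY `Nc ≥ N₁`;
* `claims_of`: the pre-registered `∃ Nc` forms `¬ HasLogicalFaultOfWeightAtMost S (w−1) ∧ HasLogicalFaultOfWeightAtMost S w`;
* `claim_shape_of`: the shape of eng-1's `Claims.lean` (`∀ Nc, 1 ≤ Nc → circuitDistance S Nc = w`) from a one-cycle witness.
Sorry-free over the named binders; nothing here asserts a value of `d_circ` for a particular code.
-/

namespace Summit.Ventures.QEC.CircuitDistance

open Literature.InformationTheory.QuantumCodes

variable {ℓ m : ℕ} [NeZero ℓ] [NeZero m]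

/-! ## The `sInf` bridge -/

/-- Monotonicity in the weight. -/
theorem hasAt_mono_weight (S : SMCode ℓ m) (Nc : ℕ) {w w' : ℕ} (h : w ≤ w') :
    HasLogicalFaultOfWeightAtMostAt S Nc w → HasLogicalFaultOfWeightAtMostAt S Nc w' := by
  rintro ⟨F, hU, hL, hw⟩; exact ⟨F, hU, hL, hw.trans h⟩

/-- **`circuitDistance` bridge.** If the `Nc`-cycle circuit has an undetectable logical fault set of `≤ w` faulty operations
and none of `≤ w − 1`, its circuit-level distance is `w`. -/
theorem circuitDistance_eq_of_hasAt (S : SMCode ℓ m) (Nc w : ℕ) (hw : 1 ≤ w)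
    (hlow : ¬ HasLogicalFaultOfWeightAtMostAt S Nc (w - 1)) (hup : HasLogicalFaultOfWeightAtMostAt S Nc w) :
    circuitDistance S Nc = w := by
  unfold circuitDistance
  set A := {w | ∃ F : Finset (Fault ℓ m), Undetectable S Nc F ∧ LogicalError S Nc F ∧ faultCount F = w} with hA
  obtain ⟨F, hU, hL, hFw⟩ := hup
  have hmemF : faultCount F ∈ A := ⟨F, hU, hL, rfl⟩
  have hFeq : faultCount F = w := by
    by_contra hne
    exact hlow ⟨F, hU, hL, by omega⟩
  have hne : A.Nonempty := ⟨_, hmemF⟩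
  have hmem := Nat.sInf_mem hne
  obtain ⟨G, hGU, hGL, hG⟩ := hmem
  have hle : sInf A ≤ w := hFeq ▸ Nat.sInf_le hmemF
  have hge : w ≤ sInf A := by
    by_contra hlt
    exact hlow ⟨G, hGU, hGL, by omega⟩
  omega

/-- Conversely, once some undetectable logical set exists, `HasAt … k ↔ circuitDistance ≤ k`. -/
theorem hasAt_iff_le_circuitDistance (S : SMCode ℓ m) (Nc w : ℕ) (hex : HasLogicalFaultOfWeightAtMostAt S Nc w) (k : ℕ) :
    HasLogicalFaultOfWeightAtMostAt S Nc k ↔ circuitDistance S Nc ≤ k := by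
  unfold circuitDistance
  set A := {w | ∃ F : Finset (Fault ℓ m), Undetectable S Nc F ∧ LogicalError S Nc F ∧ faultCount F = w} with hA
  obtain ⟨F, hU, hL, -⟩ := hex
  have hne : A.Nonempty := ⟨faultCount F, F, hU, hL, rfl⟩
  constructor
  · rintro ⟨G, hGU, hGL, hGk⟩
    have hG : faultCount G ∈ A := ⟨G, hGU, hGL, rfl⟩
    exact (Nat.sInf_le hG).trans hGk
  · intro hk
    obtain ⟨G, hGU, hGL, hG⟩ := Nat.sInf_mem hne
    exact ⟨G, hGU, hGL, hG ▸ hk⟩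


/-! ## Composition -/

/-- **COMPOSITION.** Lower bound at `N₀ = w − 1` cycles + witness of weight `≤ w` at `N₁` cycles ⇒ `d_circ = w` for all
`Nc ≥ N₁`. -/
theorem circuitDistance_eq_of (S : SMCode ℓ m) (w N₁ : ℕ) (hw : 1 ≤ w)
    (hlow : ¬ HasLogicalFaultOfWeightAtMostAt S (w - 1) (w - 1))
    (hwit : HasLogicalFaultOfWeightAtMostAt S N₁ w) (Nc : ℕ) (hNc : N₁ ≤ Nc) :
    circuitDistance S Nc = w :=
  circuitDistance_eq_of_hasAt S Nc w hw (not_hasAt_of_not_hasAt_self S (w - 1) hlow Nc) (hasAt_mono_cycles S hNc w hwit)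

/-- The pre-registered `∃ Nc` forms: `¬ HasLogicalFaultOfWeightAtMost S (w−1) ∧ HasLogicalFaultOfWeightAtMost S w`. -/
theorem claims_of (S : SMCode ℓ m) (w N₁ : ℕ)
    (hlow : ¬ HasLogicalFaultOfWeightAtMostAt S (w - 1) (w - 1))
    (hwit : HasLogicalFaultOfWeightAtMostAt S N₁ w) :
    ¬ HasLogicalFaultOfWeightAtMost S (w - 1) ∧ HasLogicalFaultOfWeightAtMost S w :=
  ⟨fun ⟨Nc, h⟩ => not_hasAt_of_not_hasAt_self S (w - 1) hlow Nc h, ⟨N₁, hwit⟩⟩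

/-- The shape of the CLAIMS of `Claims.lean`: with a one-cycle witness, `∀ Nc, 1 ≤ Nc → circuitDistance S Nc = w`. -/
theorem claim_shape_of (S : SMCode ℓ m) (w : ℕ) (hw : 1 ≤ w)
    (hlow : ¬ HasLogicalFaultOfWeightAtMostAt S (w - 1) (w - 1))
    (hwit : HasLogicalFaultOfWeightAtMostAt S 1 w) : ∀ Nc : ℕ, 1 ≤ Nc → circuitDistance S Nc = w :=
  fun Nc hNc => circuitDistance_eq_of S w 1 hw hlow hwit Nc hNc

end Summit.Ventures.QEC.CircuitDistance
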